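import Mathlib
import Literature.NumberTheory.Transcendental.KZProduct
import Literature.NumberTheory.Transcendental.KZSemiCanonicalReductionProofs
import Literature.NumberTheory.Transcendental.KZDominatedFamilyRelations
import Literature.NumberTheory.Transcendental.SemialgebraicMapsProofs
import Summits.KontsevichZagierPeriods.KontsevichZagierPeriods.Theorems.SoloInformedPolyJacobian
import Summits.KontsevichZagierPeriods.KontsevichZagierPeriods.Theorems.SoloInformedKZStokesCells
import Summits.KontsevichZagierPeriods.KontsevichZagierPeriods.Theorems.SoloInformedPiDiscQuarters
import Summits.KontsevichZagierPeriods.KontsevichZagierPeriods.Theorems.SoloInformedRevolution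
import HarnessLib
import HarnessLib.Audit

/-!
# SoloInformed — solids of revolution, II: the polynomial cylindrical change of variables

Continuing `SoloInformedRevolution`. Cylindrical coordinates `(r cos φ, r sin φ, z)` are not
available in the Kontsevich–Zagier calculus (the coefficient field is `ℚ`, the maps algebraic),
but the half-angle substitution `s = tan(φ/2)` makes them polynomial: the map

  `Φ(s, ρ, z) = (ρ(1 − s²), 2ρs, z)`,  `det Φ' = −2ρ(1 + s²)`,

sends `{0 < s < 1, 0 < ρ, (ρ(1 + s²), z) ∈ K}` bijectively onto the open first quarter
`{x₀ > 0, x₁ > 0}` of the solid of revolution `Rev K` (the distance to the axis of `Φ(s, ρ, z)`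
is `ρ(1 + s²)`). Rule (2) gives

  `soloInformed_cylSrcRep_sub_quarter_mem_relations :
      [source, 2ρ(1 + s²)] − [first quarter of Rev K, 1] ∈ relations`.

This is the three-dimensional analogue of the polar map of `SoloInformedPiDisc`. The assembly of
Pappus' theorem is in `SoloInformedPappus`.

Residency `solo-KontsevichZagierPeriods-informed` (PLAN.md, session s16).
References: M. Kontsevich, D. Zagier, *Periods* (2001), §1.2 (rule (2)).
-/

noncomputable section

open MeasureTheory Set Filter
open scoped Topology

namespace Summit.KontsevichZagierPeriods.KontsevichZagierPeriods.Theorems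

open Literature.NumberTheory.Transcendental Literature.NumberTheory.Transcendental.KZ
open Literature.ModelTheory.ExponentialFields (IsSemialgebraic isSemialgebraic_setOf_eval_le
  isSemialgebraic_setOf_eval_lt isSemialgebraic_setOf_eval_pos isSemialgebraic_setOf_eval_eq_zero)

/-! ### The cylindrical source `{0 < s < 1, 0 < ρ, (ρ(1+s²), z) ∈ K}` -/

/-- Source coordinates `(s, ρ, z)`: `{0 < s < 1, 0 < ρ, (ρ(1 + s²), z) ∈ A}`. -/
def soloInformedCylSrc (A : Set (Fin 2 → ℝ)) : Set (Fin 3 → ℝ) :=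
  {u | 0 < u 0 ∧ u 0 < 1 ∧ 0 < u 1 ∧ (![u 1 * (1 + u 0 ^ 2), u 2] : Fin 2 → ℝ) ∈ A}

/-- The source is `ℚ`-semialgebraic (a polynomial preimage; no Tarski–Seidenberg needed). -/
theorem isSemialgebraic_soloInformedCylSrc {A : Set (Fin 2 → ℝ)} (hA : IsSemialgebraic ℚ A) :
    IsSemialgebraic ℚ (soloInformedCylSrc A) := by
  have h1 := isSemialgebraic_setOf_eval_lt (k := ℚ) (R := ℝ) (0 : MvPolynomial (Fin 3) ℚ)
    (MvPolynomial.X 0)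
  have h2 := isSemialgebraic_setOf_eval_lt (k := ℚ) (R := ℝ)
    (MvPolynomial.X 0 : MvPolynomial (Fin 3) ℚ) 1
  have h3 := isSemialgebraic_setOf_eval_lt (k := ℚ) (R := ℝ) (0 : MvPolynomial (Fin 3) ℚ)
    (MvPolynomial.X 1)
  have h4 := hA.preimage_aeval (![MvPolynomial.X 1 * (1 + MvPolynomial.X 0 ^ 2), MvPolynomial.X 2] :
    Fin 2 → MvPolynomial (Fin 3) ℚ)
  have h := h1.inter (h2.inter (h3.inter h4))
  simp only [map_zero, map_one, MvPolynomial.aeval_X] at h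
  have e : ∀ u : Fin 3 → ℝ, (fun j => MvPolynomial.aeval u ((![MvPolynomial.X 1 *
      (1 + MvPolynomial.X 0 ^ 2), MvPolynomial.X 2] : Fin 2 → MvPolynomial (Fin 3) ℚ) j)) =
      (![u 1 * (1 + u 0 ^ 2), u 2] : Fin 2 → ℝ) := fun u => by
    ext j; fin_cases j <;> simp
  have hset : soloInformedCylSrc A = {u : Fin 3 → ℝ | 0 < u 0} ∩ ({u | u 0 < 1} ∩ ({u | 0 < u 1} ∩
      (fun u : Fin 3 → ℝ => fun j => MvPolynomial.aeval u ((![MvPolynomial.X 1 *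
        (1 + MvPolynomial.X 0 ^ 2), MvPolynomial.X 2] : Fin 2 → MvPolynomial (Fin 3) ℚ) j)) ⁻¹'
        A)) := by
    ext u
    simp only [soloInformedCylSrc, mem_setOf_eq, mem_inter_iff, mem_preimage, e u]
  rw [hset]
  exact h

/-- Points of the source are bounded by `max 1 R` for any sup-norm bound `R` of the region. -/
theorem soloInformedCylSrc_subset_closedBall {A : Set (Fin 2 → ℝ)} {R : ℝ}
    (hA : ∀ y ∈ A, ‖y‖ ≤ R) : soloInformedCylSrc A ⊆ Metric.closedBall 0 (max 1 R) := by
  rintro u ⟨h0, h0', h1, hmem⟩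
  have hy := hA _ hmem
  have hR1 := (norm_le_pi_norm (![u 1 * (1 + u 0 ^ 2), u 2] : Fin 2 → ℝ) 0).trans hy
  have hR2 := (norm_le_pi_norm (![u 1 * (1 + u 0 ^ 2), u 2] : Fin 2 → ℝ) 1).trans hy
  simp only [Matrix.cons_val_zero, Matrix.cons_val_one, Real.norm_eq_abs] at hR1 hR2
  have hu1 : |u 1| ≤ R := by
    rw [abs_of_pos h1]
    have : u 1 ≤ u 1 * (1 + u 0 ^ 2) := by nlinarith [sq_nonneg (u 0)]
    exact this.trans ((le_abs_self _).trans hR1)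
  have hu0 : |u 0| ≤ 1 := by rw [abs_of_pos h0]; exact h0'.le
  rw [mem_closedBall_zero_iff, pi_norm_le_iff_of_nonneg (by positivity)]
  intro i
  fin_cases i
  · simpa [Real.norm_eq_abs] using Or.inl hu0
  · simpa [Real.norm_eq_abs] using Or.inr hu1
  · simpa [Real.norm_eq_abs] using Or.inr hR2

/-- The source representation `[source, 2ρ(1 + s²)]`. -/
def soloInformedCylSrcRep (K : IntegralRep 2) (hKc : IsCompact K.domain) : IntegralRep 3 where
  domain := soloInformedCylSrc K.domain
  integrand u := 2 * u 1 * (1 + u 0 ^ 2)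
  isSemialgebraic_domain := isSemialgebraic_soloInformedCylSrc K.isSemialgebraic_domain
  isSemialgebraicFunOn_integrand := by
    have h := isSemialgebraicFunOn_aeval (isSemialgebraic_soloInformedCylSrc K.isSemialgebraic_domain)
      (MvPolynomial.C 2 * MvPolynomial.X 1 * (1 + MvPolynomial.X 0 ^ 2) : MvPolynomial (Fin 3) ℚ)
    simp only [map_mul, map_add, map_one, map_pow, MvPolynomial.aeval_X, map_ofNat] at h
    exact h
  integrableOn := by
    obtain ⟨R, hR⟩ := hKc.isBounded.exists_norm_le
    exact (((continuous_const.mul (continuous_apply 1)).mul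
      (continuous_const.add ((continuous_apply 0).pow 2))).continuousOn.integrableOn_compact
      (isCompact_closedBall (0 : Fin 3 → ℝ) (max 1 R))).mono_set
      (soloInformedCylSrc_subset_closedBall hR)

/-! ### Step 3: the polynomial cylindrical map `Φ(s, ρ, z) = (ρ(1 − s²), 2ρs, z)` -/

/-- The components of `Φ` as polynomials in `s = X 0`, `ρ = X 1`, `z = X 2`. -/
def soloInformedPolar3Poly : Fin 3 → MvPolynomial (Fin 3) ℚ :=
  ![MvPolynomial.X 1 * (1 - MvPolynomial.X 0 ^ 2),
    MvPolynomial.C 2 * (MvPolynomial.X 0 * MvPolynomial.X 1), MvPolynomial.X 2]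

/-- The polynomial cylindrical map `Φ(s, ρ, z) = (ρ(1 − s²), 2ρs, z)`. -/
def soloInformedPolar3 : (Fin 3 → ℝ) → (Fin 3 → ℝ) := soloInformedPolyMap soloInformedPolar3Poly

/-- First component of `Φ`. -/
@[simp] theorem soloInformedPolar3_apply_zero (u : Fin 3 → ℝ) :
    soloInformedPolar3 u 0 = u 1 * (1 - u 0 ^ 2) := by
  simp [soloInformedPolar3, soloInformedPolar3Poly]

/-- Second component of `Φ`. -/
@[simp] theorem soloInformedPolar3_apply_one (u : Fin 3 → ℝ) :
    soloInformedPolar3 u 1 = 2 * (u 0 * u 1) := by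
  simp [soloInformedPolar3, soloInformedPolar3Poly]

/-- Third component of `Φ`. -/
@[simp] theorem soloInformedPolar3_apply_two (u : Fin 3 → ℝ) : soloInformedPolar3 u 2 = u 2 := by
  simp [soloInformedPolar3, soloInformedPolar3Poly]

/-- **Jacobian determinant of `Φ`**: `det Φ'(s, ρ, z) = −2ρ(1 + s²)`. -/
theorem soloInformed_det_polar3 (u : Fin 3 → ℝ) :
    (soloInformedJacCLM soloInformedPolar3Poly u).det = -(2 * u 1 * (1 + u 0 ^ 2)) := by
  rw [soloInformed_det_jacCLM, Matrix.det_fin_three]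
  simp [soloInformedJacMat_apply, soloInformedPolar3Poly]
  ring

/-- The profile of `Φ(s, ρ, z)` is `(ρ(1 + s²), z)` (for `ρ ≥ 0`). -/
theorem soloInformed_profile_polar3 {u : Fin 3 → ℝ} (hu : 0 ≤ u 1) :
    soloInformedProfile (soloInformedPolar3 u) = ![u 1 * (1 + u 0 ^ 2), u 2] := by
  have h0 : Real.sqrt ((u 1 * (1 - u 0 ^ 2)) ^ 2 + (2 * (u 0 * u 1)) ^ 2) = u 1 * (1 + u 0 ^ 2) := by
    rw [show (u 1 * (1 - u 0 ^ 2)) ^ 2 + (2 * (u 0 * u 1)) ^ 2 = (u 1 * (1 + u 0 ^ 2)) ^ 2 by ring,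
      Real.sqrt_sq (by positivity)]
  unfold soloInformedProfile
  rw [soloInformedPolar3_apply_zero, soloInformedPolar3_apply_one, soloInformedPolar3_apply_two, h0]

/-- **The image of `Φ`** is the open first quarter of the solid. -/
theorem soloInformed_polar3_image (K : IntegralRep 2) (hKc : IsCompact K.domain) :
    soloInformedPolar3 '' soloInformedCylSrc K.domain =
      (soloInformedRevQuarterRep 1 1 K hKc).domain := by
  ext x
  simp only [soloInformedRevQuarterRep_domain, soloInformedRevQuarterSet, mem_setOf_eq,
    Rat.cast_one, one_mul, soloInformed_mem_rev, mem_image]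
  constructor
  · rintro ⟨u, ⟨h0, h0', h1, hmem⟩, rfl⟩
    rw [soloInformedPolar3_apply_zero, soloInformedPolar3_apply_one, soloInformed_profile_polar3 h1.le]
    have hs : u 0 ^ 2 < 1 := by nlinarith
    exact ⟨mul_pos h1 (by linarith), by positivity, hmem⟩
  · rintro ⟨h0, h1, hmem⟩
    set R : ℝ := Real.sqrt (x 0 ^ 2 + x 1 ^ 2) with hRdef
    have hR0 : 0 ≤ R := Real.sqrt_nonneg _
    have hR2 : R ^ 2 = x 0 ^ 2 + x 1 ^ 2 := Real.sq_sqrt (by positivity)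
    have hx1R : x 1 ≤ R := by
      rw [hRdef]
      exact (Real.le_sqrt h1.le (by positivity)).2 (by nlinarith)
    have hD : 0 < R + x 0 := by linarith
    have hρ : (R + x 0) / 2 * (1 + (x 1 / (R + x 0)) ^ 2) = R := by
      field_simp
      nlinarith [hR2]
    refine ⟨![x 1 / (R + x 0), (R + x 0) / 2, x 2], ⟨?_, ?_, ?_, ?_⟩, ?_⟩
    · simp only [Matrix.cons_val_zero]
      exact div_pos h1 hD
    · simp only [Matrix.cons_val_zero]
      rw [div_lt_one hD]
      linarith
    · simp only [Matrix.cons_val_one]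
      exact half_pos hD
    · have hprof : soloInformedProfile x = ![R, x 2] := by
        unfold soloInformedProfile
        rw [← hRdef]
      show (![(R + x 0) / 2 * (1 + (x 1 / (R + x 0)) ^ 2), x 2] : Fin 2 → ℝ) ∈ K.domain
      rw [hρ, ← hprof]
      exact hmem
    · have H0 : soloInformedPolar3 ![x 1 / (R + x 0), (R + x 0) / 2, x 2] 0 = x 0 := by
        rw [soloInformedPolar3_apply_zero]
        simp only [Matrix.cons_val_zero, Matrix.cons_val_one]
        field_simp
        nlinarith [hR2]
      have H1 : soloInformedPolar3 ![x 1 / (R + x 0), (R + x 0) / 2, x 2] 1 = x 1 := by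
        rw [soloInformedPolar3_apply_one]
        simp only [Matrix.cons_val_zero, Matrix.cons_val_one]
        field_simp
      have H2 : soloInformedPolar3 ![x 1 / (R + x 0), (R + x 0) / 2, x 2] 2 = x 2 := by
        rw [soloInformedPolar3_apply_two]
        simp
      ext j
      fin_cases j
      · exact H0
      · exact H1
      · exact H2

/-- **`Φ` is injective** on the source. -/
theorem soloInformed_polar3_injOn (A : Set (Fin 2 → ℝ)) :
    InjOn soloInformedPolar3 (soloInformedCylSrc A) := by
  intro u hu v hv huv
  obtain ⟨hu0, hu0', hu1, -⟩ := hu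
  obtain ⟨hv0, hv0', hv1, -⟩ := hv
  have e0 : u 1 * (1 - u 0 ^ 2) = v 1 * (1 - v 0 ^ 2) := by
    simpa only [soloInformedPolar3_apply_zero] using congr_fun huv 0
  have e1 : 2 * (u 0 * u 1) = 2 * (v 0 * v 1) := by
    simpa only [soloInformedPolar3_apply_one] using congr_fun huv 1
  have e2 : u 2 = v 2 := by simpa only [soloInformedPolar3_apply_two] using congr_fun huv 2
  have hRu : 0 < u 1 * (1 + u 0 ^ 2) := by positivity
  have hRv : 0 < v 1 * (1 + v 0 ^ 2) := by positivity
  have hR : u 1 * (1 + u 0 ^ 2) = v 1 * (1 + v 0 ^ 2) := by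
    have hsq : (u 1 * (1 + u 0 ^ 2)) ^ 2 = (v 1 * (1 + v 0 ^ 2)) ^ 2 := by
      calc (u 1 * (1 + u 0 ^ 2)) ^ 2 = (u 1 * (1 - u 0 ^ 2)) ^ 2 + (2 * (u 0 * u 1)) ^ 2 := by
            ring
        _ = (v 1 * (1 - v 0 ^ 2)) ^ 2 + (2 * (v 0 * v 1)) ^ 2 := by rw [e0, e1]
        _ = (v 1 * (1 + v 0 ^ 2)) ^ 2 := by ring
    exact (pow_left_inj₀ hRu.le hRv.le two_ne_zero).1 hsq
  have hρ : u 1 = v 1 := by linear_combination (e0 + hR) / 2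
  have hs' : u 0 * v 1 = v 0 * v 1 := by linear_combination e1 / 2 - u 0 * hρ
  have hs : u 0 = v 0 := mul_right_cancel₀ hv1.ne' hs'
  ext j
  fin_cases j
  · exact hs
  · exact hρ
  · exact e2

/-- **Step 3.** `[source, 2ρ(1+s²)] − [first quarter of the solid, 1] ∈ relations` (rule (2)
for `Φ`). -/
theorem soloInformed_cylSrcRep_sub_quarter_mem_relations (K : IntegralRep 2)
    (hKc : IsCompact K.domain) :
    of (soloInformedCylSrcRep K hKc) - of (soloInformedRevQuarterRep 1 1 K hKc) ∈ relations := by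
  refine changeOfVariablesRel_subset_relations ⟨3, soloInformedCylSrcRep K hKc,
    soloInformedRevQuarterRep 1 1 K hKc, soloInformedPolar3, soloInformedJacCLM soloInformedPolar3Poly,
    isSemialgebraicMapOn_aeval (isSemialgebraic_soloInformedCylSrc K.isSemialgebraic_domain)
      soloInformedPolar3Poly,
    fun u _ => (soloInformed_hasFDerivAt_polyMap soloInformedPolar3Poly u).hasFDerivWithinAt,
    soloInformed_polar3_injOn K.domain, (soloInformed_polar3_image K hKc).symm,
    fun u hu => ?_, rfl⟩
  obtain ⟨-, -, hu1, -⟩ := hu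
  show 2 * u 1 * (1 + u 0 ^ 2) = 1 * |(soloInformedJacCLM soloInformedPolar3Poly u).det|
  rw [soloInformed_det_polar3, abs_neg, abs_of_pos (by positivity), one_mul]

end Summit.KontsevichZagierPeriods.KontsevichZagierPeriods.Theorems
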